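import Literature.Geometry.Lorentzian.KerrObstructionInnerLayer
import Literature.Geometry.Lorentzian.KerrObstructionLinearised
import Literature.Geometry.Lorentzian.InteriorKerrGluingInterpolation
import HarnessLib

/-!
# The linear part of Li–Mei's obstruction on the glued datum: `L p + e + O(|p|²)`, `|e| ≤ Cε`

Support file (all results proved; no named facts) for the named fact `LiMei.interiorKerrGluing`
(`InteriorKerrGluing.lean`; J. Li, H. Mei, *A construction of collapsing spacetimes in vacuum*,
Comm. Math. Phys. 378 (2020) = arXiv:2005.01249, Prop. 4.1), Step S5 of the architecture recorded
in `InteriorKerrGluingReduction.lean`. It assembles `KerrObstructionLinearised` (the pairing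
`(I_α)` as a volume integral and the shell cut-off `χ = shellProfile s₁ t₁ t₂ s₂ ∘ ‖·‖`),
`KerrObstructionInnerLayer` (inner layer `= O(ε)`), `KerrObstructionOuterLayer` (outer layer
`= L p + O(|p|²)`) and the layer structure of the glued datum
`D̃(p) = preGluedDatum (M + δm, ‖b‖, R_b; c₁, c₂) D` of `InteriorKerrGluingInterpolation`
(`= D` on `‖y‖ ≤ c₁`, `=` the Kerr cylinder `(M + δm, ‖b‖, R_b)` on `c₂ ≤ ‖y‖`) into Li–Mei's
expansion of the LINEAR part of the obstruction (p. 25,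
"`𝓘(m, a⃗) = (8π(m − m₀), −8π m₀ a⃗) + (ε₀, ε₁, ε₂, ε₃) + O(ε²)`"): for radii
`1 ≤ ρ₁ < s₁ < t₁ ≤ c₁ < c₂ ≤ t₂ < s₂ < ρ₂` and the linearised pairing
`𝓛_X(p) = ∫ √g₀ χ DM_{(G₀,K₀)}(D̃(p) − (G₀, K₀))(X) dy`,

* `LiMei.abs_linearObstruction_time_sub_le` — there are `δ > 0`, `C ≥ 0` (depending only on
  `M, r₀`, the radii and the frame) such that for every datum `D` that is `ε`-close to the
  Schwarzschild cylinder on `{ρ₁ < ‖y‖ < ρ₂}` and all `|δm| + ‖b‖ ≤ δ`,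
  **`|𝓛_{∂_t}(p) − e₀(D) − 8π δm| ≤ C (|δm| + ‖b‖)²`**, where the constant term
  `e₀(D) = ∫ timeIntegrandWith M r₀ (1 − radialCutoff s₁ t₁) (coordH D − G₀, coordK D − K₀)` does
  not depend on `p` and satisfies **`|e₀(D)| ≤ C' ε`** (`LiMei.abs_innerTerm_time_le`);
* `LiMei.abs_linearObstruction_rot_sub_le`, `LiMei.abs_innerTerm_rot_le` — the same for the
  rotations `Ω_ξ = ξ × ·`, `‖ξ‖ ≤ 1`, with `−8πM⟨b, ξ⟩`.

## References

* J. Li, H. Mei, arXiv:2005.01249, §4, proof of Prop. 4.1, pp. 22–25 (key `LiMei2020`).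
-/

noncomputable section

open Set Filter Function Metric MeasureTheory
open scoped Topology RealInnerProductSpace Real Manifold ContDiff

namespace Literature.Geometry.Lorentzian

namespace LiMei

open MetricCoord

attribute [local instance] instNormedAddCommGroupBilinE3 instNormedSpaceBilinE3

section LinearPart

variable [Kerr.Facts]

/-! ### The layers of the glued datum as fields of bilinear forms -/

/-- On `‖y‖ ≤ c₁` the glued datum has the components of `D`. [cite: LiMei2020, proof of Prop. 4.1, p. 22] -/
theorem coordH_preGluedDatum_of_norm_le {m a r₀ : ℝ} (ha : |a| < m) (h₁ : Kerr.rMinus m a < r₀)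
    (h₂ : r₀ < Kerr.rPlus m a) (τ₀ : ℝ) (R : E3 →ₗᵢ[ℝ] E3) {c₁ c₂ : ℝ} (hc₁ : 0 ≤ c₁) (hc : c₁ < c₂)
    (D : InitialDataSet (𝓡 3) E3) {y : E3} (hy : ‖y‖ ≤ c₁) :
    (preGluedDatum ha h₁ h₂ τ₀ R c₁ c₂ D).coordH y = D.coordH y :=
  preGluedDatum_h_inner_of_norm_le ha h₁ h₂ τ₀ R hc₁ hc D hy

/-- On `‖y‖ ≤ c₁` the glued datum has the components of `D`. [cite: LiMei2020, proof of Prop. 4.1, p. 22] -/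
theorem coordK_preGluedDatum_of_norm_le {m a r₀ : ℝ} (ha : |a| < m) (h₁ : Kerr.rMinus m a < r₀)
    (h₂ : r₀ < Kerr.rPlus m a) (τ₀ : ℝ) (R : E3 →ₗᵢ[ℝ] E3) {c₁ c₂ : ℝ} (hc₁ : 0 ≤ c₁) (hc : c₁ < c₂)
    (D : InitialDataSet (𝓡 3) E3) {y : E3} (hy : ‖y‖ ≤ c₁) :
    (preGluedDatum ha h₁ h₂ τ₀ R c₁ c₂ D).coordK y = D.coordK y :=
  preGluedDatum_k_of_norm_le ha h₁ h₂ τ₀ R hc₁ hc D hy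

/-- On `c₂ ≤ ‖y‖` the glued datum has the components of the Kerr cylinder.
[cite: LiMei2020, proof of Prop. 4.1, p. 22] -/
theorem coordH_preGluedDatum_of_le_norm {m a r₀ : ℝ} (ha : |a| < m) (h₁ : Kerr.rMinus m a < r₀)
    (h₂ : r₀ < Kerr.rPlus m a) (τ₀ : ℝ) (R : E3 →ₗᵢ[ℝ] E3) {c₁ c₂ : ℝ} (hc₁ : 0 ≤ c₁) (hc : c₁ < c₂)
    (D : InitialDataSet (𝓡 3) E3) {y : E3} (hy : c₂ ≤ ‖y‖) :
    (preGluedDatum ha h₁ h₂ τ₀ R c₁ c₂ D).coordH y = cylH m a r₀ τ₀ R y :=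
  preGluedDatum_h_inner_of_le_norm ha h₁ h₂ τ₀ R hc₁ hc D hy

/-- On `c₂ ≤ ‖y‖` the glued datum has the components of the Kerr cylinder.
[cite: LiMei2020, proof of Prop. 4.1, p. 22] -/
theorem coordK_preGluedDatum_of_le_norm {m a r₀ : ℝ} (ha : |a| < m) (h₁ : Kerr.rMinus m a < r₀)
    (h₂ : r₀ < Kerr.rPlus m a) (τ₀ : ℝ) (R : E3 →ₗᵢ[ℝ] E3) {c₁ c₂ : ℝ} (hc₁ : 0 ≤ c₁) (hc : c₁ < c₂)
    (D : InitialDataSet (𝓡 3) E3) {y : E3} (hy : c₂ ≤ ‖y‖) :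
    (preGluedDatum ha h₁ h₂ τ₀ R c₁ c₂ D).coordK y = cylK m a (pos_of_rMinus_lt ha h₁) τ₀ R y :=
  preGluedDatum_k_of_le_norm ha h₁ h₂ τ₀ R hc₁ hc D hy

/-- The components of any datum on `E3` form a smooth symmetric variation of the Schwarzschild
cylinder on `{1 < ‖y‖}` (hypotheses of `integral_linMomFn_cutoff_dirVec_eq`). [folklore] -/
theorem variation_hypotheses {M r₀ : ℝ} (hr₀ : 0 < r₀) (h2M : r₀ < 2 * M) (τ₀ : ℝ)
    (R₀ : E3 →ₗᵢ[ℝ] E3) (D' : InitialDataSet (𝓡 3) E3) :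
    ContDiffOn ℝ ∞ (fun y ↦ D'.coordH y - cylH M 0 r₀ τ₀ R₀ y) {y : E3 | 1 < ‖y‖} ∧
      (∀ y ∈ {y : E3 | 1 < ‖y‖}, ∀ v w,
        (D'.coordH y - cylH M 0 r₀ τ₀ R₀ y) v w = (D'.coordH y - cylH M 0 r₀ τ₀ R₀ y) w v) ∧
      ContDiffOn ℝ ∞ (fun y ↦ D'.coordK y - cylK M 0 hr₀ τ₀ R₀ y) {y : E3 | 1 < ‖y‖} ∧
      (∀ y ∈ {y : E3 | 1 < ‖y‖}, ∀ v w,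
        (D'.coordK y - cylK M 0 hr₀ τ₀ R₀ y) v w = (D'.coordK y - cylK M 0 hr₀ τ₀ R₀ y) w v) := by
  have hG := isMetricOn_cylH_zero_spin hr₀ h2M τ₀ R₀
  refine ⟨(D'.contDiff_coordH.contDiffOn).sub hG.contDiffOn, fun y hy v w ↦ ?_,
    (D'.contDiff_coordK.sub (contDiff_cylK_zero_spin hr₀ h2M τ₀ R₀)).contDiffOn, fun y _ v w ↦ ?_⟩
  · rw [sub_apply, sub_apply, sub_apply, sub_apply, D'.isMetricOn_coordH.symm y (mem_univ _) v w,
      hG.symm y hy v w]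
  · rw [sub_apply, sub_apply, sub_apply, sub_apply, cylK_zero_spin_symm hr₀ h2M τ₀ R₀ y v w]
    exact congrArg (· - _) (D'.k_symm y v w)

/-! ### The inner (constant) term -/

/-- **The constant term `e₀(D)` of the linearised `∂_t`-obstruction is `O(ε)`**:
`|∫ timeIntegrandWith M r₀ (1 − radialCutoff s₁ t₁) (coordH D − G₀, coordK D − K₀)| ≤ C' ε` for
`D` `ε`-close to the Schwarzschild cylinder on `{ρ₁ < ‖y‖ < ρ₂}`, `1 ≤ ρ₁ < s₁ < t₁ < ρ₂`
(Li–Mei p. 25, `(ε₀, …)`). [cite: LiMei2020, proof of Prop. 4.1, p. 25] -/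
theorem abs_innerTerm_time_le {M r₁ r₀ ρ₁ ρ₂ s₁ t₁ : ℝ} {k : ℕ} {ε : ℝ} (hr₁ : r₁ < r₀)
    (hr₀ : 0 < r₀) (h2M : r₀ < 2 * M) (hρ₁ : 1 ≤ ρ₁) (hρs : ρ₁ < s₁) (hst : s₁ < t₁) (htρ : t₁ < ρ₂)
    (τ₀ : ℝ) (R₀ : E3 →ₗᵢ[ℝ] E3) {D : InitialDataSet (𝓡 3) E3}
    (hD : NearSchwarzschildCylinder M r₁ r₀ ρ₁ ρ₂ k ε D) :
    Integrable (fun y ↦ timeIntegrandWith M r₀ (fun x ↦ 1 - radialCutoff s₁ t₁ x)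
        (D.coordH y - cylH M 0 r₀ τ₀ R₀ y) (D.coordK y - cylK M 0 hr₀ τ₀ R₀ y) y) ∧
      |∫ y, timeIntegrandWith M r₀ (fun x ↦ 1 - radialCutoff s₁ t₁ x)
          (D.coordH y - cylH M 0 r₀ τ₀ R₀ y) (D.coordK y - cylK M 0 hr₀ τ₀ R₀ y) y| ≤
        Real.sqrt (2 * M / r₀ - 1) * (|(M - r₀) / (2 * r₀ ^ 2 * Real.sqrt (2 * M / r₀ - 1))| * 4 + 4) *
          (∫ y : E3, |deriv (fun x ↦ 1 - radialCutoff s₁ t₁ x) ‖y‖|) * ε :=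
  abs_integral_timeIntegrandWith_data_le hr₁ hr₀ h2M hρ₁ hρs htρ τ₀ R₀
    (contDiff_one_sub (contDiff_one_radialCutoff_real s₁ t₁))
    (deriv_inner_support (zero_le_one.trans (hρ₁.trans hρs.le)) hst) hD

/-- **The constant term of the linearised `Ω_ξ`-obstruction is `O(ε)`** (`‖ξ‖ ≤ 1`).
[cite: LiMei2020, proof of Prop. 4.1, p. 25] -/
theorem abs_innerTerm_rot_le {M r₁ r₀ ρ₁ ρ₂ s₁ t₁ : ℝ} {k : ℕ} {ε : ℝ} (hr₁ : r₁ < r₀)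
    (hr₀ : 0 < r₀) (h2M : r₀ < 2 * M) (hρ₁ : 1 ≤ ρ₁) (hρs : ρ₁ < s₁) (hst : s₁ < t₁) (htρ : t₁ < ρ₂)
    (τ₀ : ℝ) (R₀ : E3 →ₗᵢ[ℝ] E3) {D : InitialDataSet (𝓡 3) E3}
    (hD : NearSchwarzschildCylinder M r₁ r₀ ρ₁ ρ₂ k ε D) {ξ : E3} (hξ : ‖ξ‖ ≤ 1) :
    Integrable (fun y ↦ rotIntegrandWith M r₀ (fun x ↦ 1 - radialCutoff s₁ t₁ x) ξ
        (D.coordH y - cylH M 0 r₀ τ₀ R₀ y) (D.coordK y - cylK M 0 hr₀ τ₀ R₀ y) y) ∧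
      |∫ y, rotIntegrandWith M r₀ (fun x ↦ 1 - radialCutoff s₁ t₁ x) ξ
          (D.coordH y - cylH M 0 r₀ τ₀ R₀ y) (D.coordK y - cylK M 0 hr₀ τ₀ R₀ y) y| ≤
        (r₀ + r₀ ^ 2 / Real.sqrt (2 * M / r₀ - 1)) *
          (∫ y : E3, |deriv (fun x ↦ 1 - radialCutoff s₁ t₁ x) ‖y‖|) * ε :=
  abs_integral_rotIntegrandWith_data_le hr₁ hr₀ h2M hρ₁ hρs htρ τ₀ R₀
    (contDiff_one_sub (contDiff_one_radialCutoff_real s₁ t₁))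
    (deriv_inner_support (zero_le_one.trans (hρ₁.trans hρs.le)) hst) hD hξ

/-! ### The linear part of the obstruction on the glued datum -/

/-- **Li–Mei's expansion of the linear part of the `∂_t`-obstruction** on the glued datum
`D̃(p) = preGluedDatum (M + δm, ‖b‖, R_b; c₁, c₂) D` with the shell cut-off
`χ = shellProfile s₁ t₁ t₂ s₂ ∘ ‖·‖`, `1 ≤ ρ₁ < s₁ < t₁ ≤ c₁ < c₂ ≤ t₂ < s₂ < ρ₂`: there are `δ > 0`
and `C ≥ 0` such that for every datum `D` `ε`-close to the Schwarzschild cylinder on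
`{ρ₁ < ‖y‖ < ρ₂}` and every `p = (δm, b)` with `|δm| + ‖b‖ ≤ δ` and admissible Kerr parameters,
`|∫ √g₀ χ DM_{(G₀,K₀)}(D̃(p) − (G₀,K₀))(∂_t) dy − e₀(D) − 8π δm| ≤ C (|δm| + ‖b‖)²` with the
`p`-independent constant term `e₀(D)` of `abs_innerTerm_time_le` (Li–Mei p. 25,
"`𝓘 = (8π(m − m₀), …) + (ε₀, …) + O(ε²)`", linear part). [cite: LiMei2020, proof of Prop. 4.1, p. 25] -/
theorem abs_linearObstruction_time_sub_le {M r₁ r₀ ρ₁ ρ₂ s₁ t₁ c₁ c₂ t₂ s₂ : ℝ} {k : ℕ}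
    (hr₁ : r₁ < r₀) (hr₀ : 0 < r₀) (h2M : r₀ < 2 * M) (hρ₁ : 1 ≤ ρ₁) (hρs : ρ₁ < s₁) (hst : s₁ < t₁)
    (htc : t₁ ≤ c₁) (hc : c₁ < c₂) (hct : c₂ ≤ t₂) (hts : t₂ < s₂) (hsρ : s₂ < ρ₂) (τ₀ : ℝ)
    (R₀ : E3 →ₗᵢ[ℝ] E3) :
    ∃ δ C : ℝ, 0 < δ ∧ 0 ≤ C ∧ ∀ (ε : ℝ) (D : InitialDataSet (𝓡 3) E3),
      NearSchwarzschildCylinder M r₁ r₀ ρ₁ ρ₂ k ε D →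
      ∀ p : ℝ × E3, |p.1| + ‖p.2‖ ≤ δ →
        ∀ (ha : |‖p.2‖| < M + p.1) (h₁ : Kerr.rMinus (M + p.1) ‖p.2‖ < r₀)
          (h₂ : r₀ < Kerr.rPlus (M + p.1) ‖p.2‖),
          |(∫ y, sqrtDetGram (cylH M 0 r₀ τ₀ R₀) (EuclideanSpace.basisFun (Fin 3) ℝ).toBasis y *
                (shellProfile s₁ t₁ t₂ s₂ ‖y‖ *
                  linMomFn (EuclideanSpace.basisFun (Fin 3) ℝ).toBasis (cylH M 0 r₀ τ₀ R₀)
                    (cylK M 0 hr₀ τ₀ R₀)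
                    (fun z ↦ (preGluedDatum ha h₁ h₂ τ₀ (spinIsometry p.2) c₁ c₂ D).coordH z -
                      cylH M 0 r₀ τ₀ R₀ z)
                    (fun z ↦ (preGluedDatum ha h₁ h₂ τ₀ (spinIsometry p.2) c₁ c₂ D).coordK z -
                      cylK M 0 hr₀ τ₀ R₀ z) y (dirVec y))) -
              (∫ y, timeIntegrandWith M r₀ (fun x ↦ 1 - radialCutoff s₁ t₁ x)
                (D.coordH y - cylH M 0 r₀ τ₀ R₀ y) (D.coordK y - cylK M 0 hr₀ τ₀ R₀ y) y) -
              8 * π * p.1| ≤ C * (|p.1| + ‖p.2‖) ^ 2 := by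
  have hρt₂ : ρ₁ < t₂ := by linarith
  have htρ : t₁ < ρ₂ := by linarith
  have hs₁1 : 1 < s₁ := lt_of_le_of_lt hρ₁ hρs
  have hs₁0 : 0 ≤ s₁ := zero_le_one.trans hs₁1.le
  have ht₂0 : 0 ≤ t₂ := by linarith
  have hc₁0 : 0 ≤ c₁ := by linarith
  obtain ⟨δ, C, hδ, hC, hout⟩ := exists_abs_integral_timeIntegrandWith_sub_le hr₀ h2M τ₀ R₀ hρ₁ hρt₂ hsρ
    (contDiff_one_radialCutoff_real t₂ s₂) (radialCutoff_real_of_abs_le ht₂0 hts)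
    (radialCutoff_real_of_le_abs ht₂0 hts)
  refine ⟨δ, C, hδ, hC, fun ε D hD p hp ha h₁ h₂ ↦ ?_⟩
  obtain ⟨hχE, hχ, h0in, h0out⟩ := shellProfile_hypotheses hs₁1 hst (htc.trans (hc.le.trans hct)) hts
  set D' := preGluedDatum ha h₁ h₂ τ₀ (spinIsometry p.2) c₁ c₂ D with hD'
  obtain ⟨hγ, hγs, hκ, hκs⟩ := variation_hypotheses hr₀ h2M τ₀ R₀ D'
  -- Step 1: the pairing is the volume integral of the explicit integrand
  rw [integral_linMomFn_cutoff_dirVec_eq hr₀ h2M τ₀ R₀ hs₁1 hχE hχ h0in h0out hγ hγs hκ hκs]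
  -- Step 2: split the integrand along the shell profile and identify the two layers pointwise
  have hsplit : ∀ y : E3, timeIntegrandWith M r₀ (shellProfile s₁ t₁ t₂ s₂)
      (D'.coordH y - cylH M 0 r₀ τ₀ R₀ y) (D'.coordK y - cylK M 0 hr₀ τ₀ R₀ y) y =
      timeIntegrandWith M r₀ (fun x ↦ 1 - radialCutoff s₁ t₁ x)
          (D.coordH y - cylH M 0 r₀ τ₀ R₀ y) (D.coordK y - cylK M 0 hr₀ τ₀ R₀ y) y +
        timeIntegrandWith M r₀ (radialCutoff t₂ s₂)
          (cylH (M + p.1) ‖p.2‖ r₀ τ₀ (spinIsometry p.2) y - cylH M 0 r₀ τ₀ R₀ y)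
          (cylK (M + p.1) ‖p.2‖ hr₀ τ₀ (spinIsometry p.2) y - cylK M 0 hr₀ τ₀ R₀ y) y := by
    intro y
    rw [timeIntegrandWith_shellProfile M r₀ hs₁0 hst (htc.trans (hc.le.trans hct)) hts]
    congr 1
    · -- inner layer: either the inner derivative vanishes, or `‖y‖ ≤ t₁ ≤ c₁` and `D̃ = D`
      by_cases hd : deriv (fun x ↦ 1 - radialCutoff s₁ t₁ x) ‖y‖ = 0
      · rw [timeIntegrandWith_eq_zero M r₀ _ _ hd, timeIntegrandWith_eq_zero M r₀ _ _ hd]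
      · have hy : ‖y‖ ≤ c₁ := by
          have h := (deriv_inner_support hs₁0 hst ‖y‖ hd).2
          rw [abs_norm] at h
          exact h.trans htc
        rw [hD', coordH_preGluedDatum_of_norm_le ha h₁ h₂ τ₀ _ hc₁0 hc D hy,
          coordK_preGluedDatum_of_norm_le ha h₁ h₂ τ₀ _ hc₁0 hc D hy]
    · -- outer layer: either the outer derivative vanishes, or `c₂ ≤ t₂ ≤ ‖y‖` and `D̃ = Kerr(p)`
      by_cases hd : deriv (radialCutoff t₂ s₂) ‖y‖ = 0
      · rw [timeIntegrandWith_eq_zero M r₀ _ _ hd, timeIntegrandWith_eq_zero M r₀ _ _ hd]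
      · have hy : c₂ ≤ ‖y‖ := by
          have h := (deriv_cutoffProfile_support (radialCutoff_real_of_abs_le ht₂0 hts)
            (radialCutoff_real_of_le_abs ht₂0 hts) ‖y‖ hd).1
          rw [abs_norm] at h
          exact hct.trans h
        rw [hD', coordH_preGluedDatum_of_le_norm ha h₁ h₂ τ₀ _ hc₁0 hc D hy,
          coordK_preGluedDatum_of_le_norm ha h₁ h₂ τ₀ _ hc₁0 hc D hy]
  simp_rw [hsplit]
  -- Step 3: integrate the two layers separately
  obtain ⟨hinI, -⟩ := abs_innerTerm_time_le hr₁ hr₀ h2M hρ₁ hρs hst htρ τ₀ R₀ hD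
  obtain ⟨houtI, houtB⟩ := hout p hp
  rw [integral_add hinI houtI]
  convert houtB using 2
  ring

/-- **Li–Mei's expansion of the linear part of the `Ω_ξ`-obstruction** on the glued datum
(`‖ξ‖ ≤ 1`): `|∫ √g₀ χ DM(D̃(p) − (G₀,K₀))(Ω_ξ) dy − e_ξ(D) + 8πM⟨b, ξ⟩| ≤ C (|δm| + ‖b‖)²` with the
`p`-independent constant term of `abs_innerTerm_rot_le`. [cite: LiMei2020, proof of Prop. 4.1, p. 25] -/
theorem abs_linearObstruction_rot_sub_le {M r₁ r₀ ρ₁ ρ₂ s₁ t₁ c₁ c₂ t₂ s₂ : ℝ} {k : ℕ}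
    (hr₁ : r₁ < r₀) (hr₀ : 0 < r₀) (h2M : r₀ < 2 * M) (hρ₁ : 1 ≤ ρ₁) (hρs : ρ₁ < s₁) (hst : s₁ < t₁)
    (htc : t₁ ≤ c₁) (hc : c₁ < c₂) (hct : c₂ ≤ t₂) (hts : t₂ < s₂) (hsρ : s₂ < ρ₂) (τ₀ : ℝ)
    (R₀ : E3 →ₗᵢ[ℝ] E3) :
    ∃ δ C : ℝ, 0 < δ ∧ 0 ≤ C ∧ ∀ (ε : ℝ) (D : InitialDataSet (𝓡 3) E3),
      NearSchwarzschildCylinder M r₁ r₀ ρ₁ ρ₂ k ε D →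
      ∀ p : ℝ × E3, |p.1| + ‖p.2‖ ≤ δ → ∀ ξ : E3, ‖ξ‖ ≤ 1 →
        ∀ (ha : |‖p.2‖| < M + p.1) (h₁ : Kerr.rMinus (M + p.1) ‖p.2‖ < r₀)
          (h₂ : r₀ < Kerr.rPlus (M + p.1) ‖p.2‖),
          |(∫ y, sqrtDetGram (cylH M 0 r₀ τ₀ R₀) (EuclideanSpace.basisFun (Fin 3) ℝ).toBasis y *
                (shellProfile s₁ t₁ t₂ s₂ ‖y‖ *
                  linMomFn (EuclideanSpace.basisFun (Fin 3) ℝ).toBasis (cylH M 0 r₀ τ₀ R₀)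
                    (cylK M 0 hr₀ τ₀ R₀)
                    (fun z ↦ (preGluedDatum ha h₁ h₂ τ₀ (spinIsometry p.2) c₁ c₂ D).coordH z -
                      cylH M 0 r₀ τ₀ R₀ z)
                    (fun z ↦ (preGluedDatum ha h₁ h₂ τ₀ (spinIsometry p.2) c₁ c₂ D).coordK z -
                      cylK M 0 hr₀ τ₀ R₀ z) y (crossCLM ξ y))) -
              (∫ y, rotIntegrandWith M r₀ (fun x ↦ 1 - radialCutoff s₁ t₁ x) ξ
                (D.coordH y - cylH M 0 r₀ τ₀ R₀ y) (D.coordK y - cylK M 0 hr₀ τ₀ R₀ y) y) +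
              8 * π * M * ⟪p.2, ξ⟫| ≤ C * (|p.1| + ‖p.2‖) ^ 2 := by
  have hρt₂ : ρ₁ < t₂ := by linarith
  have htρ : t₁ < ρ₂ := by linarith
  have hs₁1 : 1 < s₁ := lt_of_le_of_lt hρ₁ hρs
  have hs₁0 : 0 ≤ s₁ := zero_le_one.trans hs₁1.le
  have ht₂0 : 0 ≤ t₂ := by linarith
  have hc₁0 : 0 ≤ c₁ := by linarith
  obtain ⟨δ, C, hδ, hC, hout⟩ := exists_abs_integral_rotIntegrandWith_sub_le hr₀ h2M τ₀ R₀ hρ₁ hρt₂ hsρ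
    (contDiff_one_radialCutoff_real t₂ s₂) (radialCutoff_real_of_abs_le ht₂0 hts)
    (radialCutoff_real_of_le_abs ht₂0 hts)
  refine ⟨δ, C, hδ, hC, fun ε D hD p hp ξ hξ ha h₁ h₂ ↦ ?_⟩
  obtain ⟨hχE, hχ, h0in, h0out⟩ := shellProfile_hypotheses hs₁1 hst (htc.trans (hc.le.trans hct)) hts
  set D' := preGluedDatum ha h₁ h₂ τ₀ (spinIsometry p.2) c₁ c₂ D with hD'
  obtain ⟨hγ, hγs, hκ, hκs⟩ := variation_hypotheses hr₀ h2M τ₀ R₀ D'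
  rw [integral_linMomFn_cutoff_crossCLM_eq hr₀ h2M τ₀ R₀ ξ hs₁1 hχE hχ h0in h0out hγ hγs hκ hκs]
  have hsplit : ∀ y : E3, rotIntegrandWith M r₀ (shellProfile s₁ t₁ t₂ s₂) ξ
      (D'.coordH y - cylH M 0 r₀ τ₀ R₀ y) (D'.coordK y - cylK M 0 hr₀ τ₀ R₀ y) y =
      rotIntegrandWith M r₀ (fun x ↦ 1 - radialCutoff s₁ t₁ x) ξ
          (D.coordH y - cylH M 0 r₀ τ₀ R₀ y) (D.coordK y - cylK M 0 hr₀ τ₀ R₀ y) y +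
        rotIntegrandWith M r₀ (radialCutoff t₂ s₂) ξ
          (cylH (M + p.1) ‖p.2‖ r₀ τ₀ (spinIsometry p.2) y - cylH M 0 r₀ τ₀ R₀ y)
          (cylK (M + p.1) ‖p.2‖ hr₀ τ₀ (spinIsometry p.2) y - cylK M 0 hr₀ τ₀ R₀ y) y := by
    intro y
    rw [rotIntegrandWith_shellProfile M r₀ hs₁0 hst (htc.trans (hc.le.trans hct)) hts]
    congr 1
    · by_cases hd : deriv (fun x ↦ 1 - radialCutoff s₁ t₁ x) ‖y‖ = 0
      · rw [rotIntegrandWith_eq_zero M r₀ ξ _ _ hd, rotIntegrandWith_eq_zero M r₀ ξ _ _ hd]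
      · have hy : ‖y‖ ≤ c₁ := by
          have h := (deriv_inner_support hs₁0 hst ‖y‖ hd).2
          rw [abs_norm] at h
          exact h.trans htc
        rw [hD', coordH_preGluedDatum_of_norm_le ha h₁ h₂ τ₀ _ hc₁0 hc D hy,
          coordK_preGluedDatum_of_norm_le ha h₁ h₂ τ₀ _ hc₁0 hc D hy]
    · by_cases hd : deriv (radialCutoff t₂ s₂) ‖y‖ = 0
      · rw [rotIntegrandWith_eq_zero M r₀ ξ _ _ hd, rotIntegrandWith_eq_zero M r₀ ξ _ _ hd]
      · have hy : c₂ ≤ ‖y‖ := by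
          have h := (deriv_cutoffProfile_support (radialCutoff_real_of_abs_le ht₂0 hts)
            (radialCutoff_real_of_le_abs ht₂0 hts) ‖y‖ hd).1
          rw [abs_norm] at h
          exact hct.trans h
        rw [hD', coordH_preGluedDatum_of_le_norm ha h₁ h₂ τ₀ _ hc₁0 hc D hy,
          coordK_preGluedDatum_of_le_norm ha h₁ h₂ τ₀ _ hc₁0 hc D hy]
  simp_rw [hsplit]
  obtain ⟨hinI, -⟩ := abs_innerTerm_rot_le hr₁ hr₀ h2M hρ₁ hρs hst htρ τ₀ R₀ hD hξ
  obtain ⟨houtI, houtB⟩ := hout p hp ξ hξ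
  rw [integral_add hinI houtI]
  convert houtB using 2
  ring

end LinearPart

end LiMei

end Literature.Geometry.Lorentzian

end
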